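import Mathlib
import Summits.CriticalPhenomena.PercolationContinuityZ3.Theorems.PercNearOneGluingNoHeavyLowerTailKnQuestion8AntitheticTowerBounds

/-!
# The source tower calculus, IV: the `T`-side bound and HUB_k, BASE_k for every level

Support file (seat `prim-ineq-gen-7` gen 31; helper for `stmt-CriticalPhenomena-4575`).  No `sorry`.
Memo: run/shared/lean/prim/prim-ineq-gen-7/FINDING-TOWER-g31.md §4d, PROOF-TOWER-g31.md §5.  `V_bound`: the hub-top side
`zT·prod(T) + T4(B∨AL;T;D1) ≥ −1` with equality only in the characterized case; `hub`: THE 1-SLICE LEMMA OF THE HUB STEP AT EVERY TOWER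
LEVEL (HUB_k, all `k`); `base`: the empty-forest invariant (BASE_k, all `k`).  With the formal ⋈-step and the hub identity of the memo
(pencil, numerically anchored to depth 3) these give L-PURE for every rooted tree of root degree 1.

* `AntitheticTower.V_bound`, `AntitheticTower.hub` (HUB_k ∀k), `AntitheticTower.base` (BASE_k ∀k).
-/

namespace Summit.CriticalPhenomena.PercolationContinuityZ3.Theorems

namespace AntitheticTower

/-- `V ≥ −1`, and `V = −1` only in the characterized case (routes/forced vector `X`, memberships `Tm`). -/
theorem V_bound (k : ℕ) (X Tm : Q4) (zT : Bool) (D : Cfg4 k)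
    (hXT : Q4.sub X Tm = true) (hf : alls k D (fun v => Q4.sub X v.s) = true)
    (hLT : Q4.sub (lamU4 k D) Tm = true) (hLs : alls k D (fun v => Q4.sub (lamU4 k D) v.s) = true) :
    -1 ≤ (if zT then prod4 Tm else 0) + T4 k X Tm zT D ∧
    ((if zT then prod4 Tm else 0) + T4 k X Tm zT D = -1 → charV X Tm = true) := by
  set L := lamU4 k D with hLdef
  have hl : alls k D (fun v => Q4.sub v.l L) = true := alls_sub_lamU4 k D L (Q4.sub_refl _)
  -- Boolean facts about prod
  have prod_ge : ∀ Tm : Q4, -1 ≤ prod4 Tm := by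
    intro Tm; rcases Tm with ⟨t1, t2, t3, t4⟩; cases t1 <;> cases t2 <;> cases t3 <;> cases t4 <;> decide
  have prod_le : ∀ Tm : Q4, prod4 Tm ≤ 1 := by
    intro Tm; rcases Tm with ⟨t1, t2, t3, t4⟩; cases t1 <;> cases t2 <;> cases t3 <;> cases t4 <;> decide
  have prod_both : ∀ Tm : Q4, touch true Tm = true → touch false Tm = true → 0 ≤ prod4 Tm := by
    intro Tm; rcases Tm with ⟨t1, t2, t3, t4⟩; cases t1 <;> cases t2 <;> cases t3 <;> cases t4 <;> decide
  by_cases hdead : touch true L = true ∧ touch false L = true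
  · have hT1 := touch_mono true L Tm hLT hdead.1; have hT2 := touch_mono false L Tm hLT hdead.2
    have hn : alls k D nocert = true :=
      alls_mono (fun v hv => by
        simp only [nocert, Bool.and_eq_true]; exact ⟨touch_mono true L v.s hv hdead.1, touch_mono false L v.s hv hdead.2⟩) k D hLs
    rw [T4_dead k X Tm zT D hT1 hT2 hn]
    have := prod_both Tm hT1 hT2
    cases zT
    · simp
    · simp; omega
  by_cases hzero : L = Q4.zero
  · have hp : alls k D plain = true := alls_plain_of_lamU4 k D (by rw [← hLdef, hzero])
    rw [T4_plain k X Tm zT D hp]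
    have hc := csum_nonneg k X D
    have h2 := bi_nonneg (zT && cert4 X Tm)
    have key : ∀ (X Tm : Q4), Q4.sub X Tm = true → prod4 Tm = -1 → cert4 X Tm = false → charV X Tm = true := by
      intro X Tm
      rcases X with ⟨x1, x2, x3, x4⟩; rcases Tm with ⟨t1, t2, t3, t4⟩
      cases x1 <;> cases x2 <;> cases x3 <;> cases x4 <;> cases t1 <;> cases t2 <;> cases t3 <;> cases t4 <;> decide
    cases zT with
    | false => simp only [Bool.false_eq_true, ite_false, Bool.false_and, bi_false]; omega
    | true =>
        simp only [ite_true, Bool.true_and]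
        have hpg := prod_ge Tm
        have hb0 := bi_nonneg (cert4 X Tm)
        refine ⟨by omega, fun he => ?_⟩
        have hpr : prod4 Tm = -1 := by omega
        have hce : cert4 X Tm = false := by
          by_contra hc'; have h1 : cert4 X Tm = true := by simpa using hc'
          rw [h1] at he; simp only [bi_true] at he; omega
        exact key X Tm hXT hpr hce
  · have ht : ∃ t : Bool, inside t L = true := by
      rcases L with ⟨l1, l2, l3, l4⟩
      simp only [touch] at hdead
      refine (?_ : ∃ t : Bool, inside t ⟨l1, l2, l3, l4⟩ = true)
      revert hdead; cases l1 <;> cases l2 <;> cases l3 <;> cases l4 <;> decide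
    obtain ⟨t, htL⟩ := ht
    have hLt : touch t L = true := touch_of_inside t L htL hzero
    have hTt : touch t Tm = true := touch_mono t L Tm hLT hLt
    have hw : alls k D (worldOK t) = true := by
      have := alls_and k D hLs hl
      exact alls_mono (fun v hv => by
        simp only [Bool.and_eq_true] at hv
        simp only [worldOK, Bool.and_eq_true]
        exact ⟨touch_mono t L v.s hv.1 hLt, inside_anti t v.l L hv.2 htL⟩) k D this
    rw [T4_world t k X Tm zT D hTt hw]
    have hfullT : full (pr t L) = true → full (pr t Tm) = true := full_pr_mono t L Tm hLT
    have hge := T_ge_neg_one k (pr t X) (opn t Tm) zT (prD t k D)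
    -- openness of X via closedness
    have hopenX : T k (pr t X) (opn t Tm) zT (prD t k D) = -1 → opn t X = true := by
      intro he
      by_contra hc
      have hX : opn t X = false := by simpa using hc
      have hcl := closedM_prD t X hX k D hf
      have hTc : opn t Tm = false := by
        by_contra hu; have hu' : opn t Tm = true := by simpa using hu
        have := opn_anti t X Tm hXT hu'; rw [hX] at this; exact Bool.false_ne_true this
      rw [hTc] at he
      have := T_closed k (pr t X) zT (prD t k D) hcl; omega
    -- Boolean facts relating prod, touch, open, exact rho
    have prod_neg_open : ∀ (t : Bool) (Tm : Q4), prod4 Tm = -1 → touch t Tm = true → opn t Tm = true ∧ full (pr t Tm) = true ∧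
        ∀ X : Q4, Q4.sub X Tm = true → opn t X = true := by
      intro t Tm
      rcases Tm with ⟨t1, t2, t3, t4⟩
      cases t <;> cases t1 <;> cases t2 <;> cases t3 <;> cases t4 <;> simp [prod4, bi, touch, opn, pr, full] <;>
        (intro X; rcases X with ⟨x1, x2, x3, x4⟩; cases x1 <;> cases x2 <;> cases x3 <;> cases x4 <;> decide)
    have prod_closed : ∀ (t : Bool) (Tm : Q4), touch t Tm = true → opn t Tm = false → 0 ≤ prod4 Tm := by
      intro t Tm
      rcases Tm with ⟨t1, t2, t3, t4⟩
      cases t <;> cases t1 <;> cases t2 <;> cases t3 <;> cases t4 <;> decide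
    cases zT with
    | false =>
        simp only [Bool.false_eq_true, ite_false, zero_add]
        refine ⟨hge, fun he => ?_⟩
        obtain ⟨hnf, hlam⟩ := T_eq_neg_one k (pr t X) (opn t Tm) false (prD t k D) he
        rw [lamU_prD] at hlam
        have hfT := hfullT hlam
        have hoX := hopenX he
        simp only [charV]; cases t <;> simp_all
    | true =>
        simp only [ite_true]
        by_cases hoT : opn t Tm = true
        · rw [hoT] at hge ⊢
          have h0 := T_open_charged_nonneg k (pr t X) (prD t k D)
          have hpg := prod_ge Tm
          refine ⟨by omega, fun he => ?_⟩
          have hpr : prod4 Tm = -1 := by omega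
          have hτ : T k (pr t X) true true (prD t k D) = 0 := by omega
          obtain ⟨_, hfT, hoall⟩ := prod_neg_open t Tm hpr hTt
          have hnf : full (pr t X) = false := by
            by_contra hc; have hc' : full (pr t X) = true := by simpa using hc
            have := T_full_pos k (pr t X) (prD t k D) hc'; omega
          have hoX := hoall X hXT
          simp only [charV]; cases t <;> simp_all
        · have hoT' : opn t Tm = false := by simpa using hoT
          rw [hoT'] at hge ⊢
          have hp0 := prod_closed t Tm hTt hoT'
          refine ⟨by omega, fun he => ?_⟩
          have hτ : T k (pr t X) false true (prD t k D) = -1 := by have := prod_le Tm; omega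
          obtain ⟨hnf, hlam⟩ := T_eq_neg_one k (pr t X) false true (prD t k D) hτ
          rw [lamU_prD] at hlam
          have hfT := hfullT hlam
          have hoX : opn t X = true := by
            by_contra hc
            have hX : opn t X = false := by simpa using hc
            have hcl := closedM_prD t X hX k D hf
            have := T_closed k (pr t X) true (prD t k D) hcl; omega
          simp only [charV]; cases t <;> simp_all

/-! ### HUB_k and BASE_k for every k -/

/-- `q(B) = prod(B) + cert(T,B) ≥ 0` for `B ⊆ T`. -/
theorem qB_nonneg (B T : Q4) (h : Q4.sub B T = true) : 0 ≤ prod4 B + bi (cert4 T B) := by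
  rcases B with ⟨b1, b2, b3, b4⟩; rcases T with ⟨t1, t2, t3, t4⟩; revert h
  cases b1 <;> cases b2 <;> cases b3 <;> cases b4 <;> cases t1 <;> cases t2 <;> cases t3 <;> cases t4 <;> decide

/-- Unpacking `charW`. -/
theorem charW_cases (B AL : Q4) (h : charW B AL = true) :
    ∃ t : Bool, full (pr t AL) = true ∧ full (pr t B) = false ∧ opn t (Q4.sup B AL) = true := by
  simp only [charW, Bool.or_eq_true, Bool.and_eq_true, Bool.not_eq_true'] at h
  rcases h with ⟨⟨h1, h2⟩, h3⟩ | ⟨⟨h1, h2⟩, h3⟩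
  · exact ⟨true, h1, h2, h3⟩
  · exact ⟨false, h1, h2, h3⟩

/-- Unpacking `charV`. -/
theorem charV_cases (X T : Q4) (h : charV X T = true) :
    ∃ t : Bool, full (pr t T) = true ∧ full (pr t X) = false ∧ opn t X = true := by
  simp only [charV, Bool.or_eq_true, Bool.and_eq_true, Bool.not_eq_true'] at h
  rcases h with ⟨⟨h1, h2⟩, h3⟩ | ⟨⟨h1, h2⟩, h3⟩
  · exact ⟨true, h1, h2, h3⟩
  · exact ⟨false, h1, h2, h3⟩

/-- A τ-side loss is paid by the hub bottom: `charW → q(B) ≥ 1`. -/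
theorem qB_of_charW (B AL T : Q4) (hA : Q4.sub AL T = true) (hc : charW B AL = true) :
    1 ≤ prod4 B + bi (cert4 T B) := by
  obtain ⟨t, hfA, hnB, hoX⟩ := charW_cases B AL hc
  have hoB : opn t B = true := opn_anti t B _ (Q4.sub_sup_left B AL) hoX
  have hfT : full (pr t T) = true := full_pr_mono t AL T hA hfA
  have hcert : cert4 T B = true := cert4_intro t T B hfT hoB
  have hp := prod_nonneg_of_open t B hoB hnB
  rw [hcert]; simp only [bi_true]; omega

/-- A T-side loss is paid by the hub bottom: `charV (B ∨ AL) T → q(B) ≥ 1`. -/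
theorem qB_of_charV (B AL T : Q4) (hc : charV (Q4.sup B AL) T = true) : 1 ≤ prod4 B + bi (cert4 T B) := by
  obtain ⟨t, hfT, hnX, hoX⟩ := charV_cases _ T hc
  have hoB : opn t B = true := opn_anti t B _ (Q4.sub_sup_left B AL) hoX
  have hnB : full (pr t B) = false := by
    by_contra h; have h' : full (pr t B) = true := by simpa using h
    have := full_pr_sup_left t B AL h'; rw [hnX] at this; exact Bool.false_ne_true this
  have hcert : cert4 T B = true := cert4_intro t T B hfT hoB
  have hp := prod_nonneg_of_open t B hoB hnB
  rw [hcert]; simp only [bi_true]; omega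

/-- The two losses exclude each other. -/
theorem charW_charV_excl (B AL T : Q4) (hW : charW B AL = true) (hV : charV (Q4.sup B AL) T = true) : False := by
  obtain ⟨t1, hfA, _, hoX1⟩ := charW_cases B AL hW
  obtain ⟨t2, _, hnX, hoX2⟩ := charV_cases _ T hV
  by_cases ht : t1 = t2
  · subst ht
    have := full_pr_sup_right t1 B AL hfA; rw [hnX] at this; exact Bool.false_ne_true this
  · have hne : t2 = !t1 := by cases t1 <;> cases t2 <;> simp_all
    have := not_opn_other t1 AL (Q4.sup B AL) hfA (Q4.sub_sup_right B AL)
    rw [← hne, hoX2] at this; exact Bool.noConfusion this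

/-- THEOREM HUB_k (all `k`): the 1-slice lemma of the hub step at every tower level.  Level bits `B, T, U, AL` (hub bottom,
hub top, `F′`-top memberships, `α`-routes), charges `zT, zU` (`zB = 1`), configurations `D1` at `T_y` (routes `B ∨ AL`) and `D2`
at `τ_y` (routes `B`, instance routes `AL`); hypotheses: `B, AL ⊆ T ∩ U`, forced memberships `⊇ B ∨ AL`, and the W-rule (every
membership of the level contains the union `Λ` of all own routes). -/
theorem hub (k : ℕ) (B T U AL : Q4) (zT zU : Bool) (D1 D2 : Cfg4 k)
    (hBT : Q4.sub (Q4.sup B AL) T = true) (hBU : Q4.sub (Q4.sup B AL) U = true)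
    (hf1 : alls k D1 (fun v => Q4.sub (Q4.sup B AL) v.s) = true) (hf2 : alls k D2 (fun v => Q4.sub (Q4.sup B AL) v.s) = true)
    (hLT : Q4.sub (Q4.sup (lamU4 k D1) (lamU4 k D2)) T = true) (hLU : Q4.sub (Q4.sup (lamU4 k D1) (lamU4 k D2)) U = true)
    (hL1 : alls k D1 (fun v => Q4.sub (Q4.sup (lamU4 k D1) (lamU4 k D2)) v.s) = true)
    (hL2 : alls k D2 (fun v => Q4.sub (Q4.sup (lamU4 k D1) (lamU4 k D2)) v.s) = true) :
    0 ≤ prod4 B + bi (cert4 T B) + (if zT then prod4 T else 0)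
        + T4 k (Q4.sup B AL) T zT D1 + T4 k B U zU D2 - m4 k AL U zU D2 := by
  -- restrict the W-rule to each configuration's own Λ
  have s1 := Q4.sub_sup_left (lamU4 k D1) (lamU4 k D2)
  have s2 := Q4.sub_sup_right (lamU4 k D1) (lamU4 k D2)
  have hB_T : Q4.sub B T = true := Q4.sub_trans _ _ _ (Q4.sub_sup_left B AL) hBT
  have hA_T : Q4.sub AL T = true := Q4.sub_trans _ _ _ (Q4.sub_sup_right B AL) hBT
  have hV := V_bound k (Q4.sup B AL) T zT D1 hBT hf1 (Q4.sub_trans _ _ _ s1 hLT)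
    (alls_mono (fun v hv => Q4.sub_trans _ _ _ s1 hv) k D1 hL1)
  have hW := W_bound k B AL U zU D2 hBU hf2 (Q4.sub_trans _ _ _ s2 hLU)
    (alls_mono (fun v hv => Q4.sub_trans _ _ _ s2 hv) k D2 hL2)
  have hq := qB_nonneg B T hB_T
  obtain ⟨hV1, hV2⟩ := hV; obtain ⟨hW1, hW2⟩ := hW
  set V := (if zT then prod4 T else 0) + T4 k (Q4.sup B AL) T zT D1 with hVdef
  set W := T4 k B U zU D2 - m4 k AL U zU D2 with hWdef
  rcases (show V = -1 ∨ 0 ≤ V by omega) with hv | hv <;> rcases (show W = -1 ∨ 0 ≤ W by omega) with hw | hw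
  · exact (charW_charV_excl B AL T (hW2 hw) (hV2 hv)).elim
  · have := qB_of_charV B AL T (hV2 hv); omega
  · have := qB_of_charW B AL T hA_T (hW2 hw); omega
  · omega

/-- THEOREM BASE_k (all `k`): the tower invariant for the empty forest (`P = {b < t}`): memberships `b ⊆ t`, charge of the top
`zt` (`zb = 1`), routes and forced vector `b`, W-rule w.r.t. `t`. -/
theorem base (k : ℕ) (b t : Q4) (zt : Bool) (D : Cfg4 k)
    (hbt : Q4.sub b t = true) (hf : alls k D (fun v => Q4.sub b v.s) = true)
    (hLT : Q4.sub (lamU4 k D) t = true) (hLs : alls k D (fun v => Q4.sub (lamU4 k D) v.s) = true) :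
    0 ≤ prod4 b + bi (cert4 t b) + (if zt then prod4 t else 0) + T4 k b t zt D := by
  have hV := V_bound k b t zt D hbt hf hLT hLs
  have hq := qB_nonneg b t hbt
  have key : charV b t = true → 1 ≤ prod4 b + bi (cert4 t b) := by
    have := qB_of_charV b Q4.zero t
    rw [Q4.sup_zero] at this; exact this
  obtain ⟨h1, h2⟩ := hV
  rcases (show (if zt then prod4 t else 0) + T4 k b t zt D = -1 ∨ 0 ≤ (if zt then prod4 t else 0) + T4 k b t zt D by omega) with h | h
  · have := key (h2 h); omega
  · omega


end AntitheticTower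

end Summit.CriticalPhenomena.PercolationContinuityZ3.Theorems
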